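import Literature.AlgebraicGeometry.Modules.CechLocalizedBicomplex
import Literature.AlgebraicGeometry.Modules.CechLocalizedSectionsAffineLocalizing
import Literature.AlgebraicGeometry.Modules.AffineLocalizingBiproduct
import Literature.AlgebraicGeometry.Modules.TildeGlobalSectionsQuasiIso
import Literature.AlgebraicGeometry.Modules.IdealSheafNoetherian
import Literature.AlgebraicGeometry.Motives.AbelianVariety
import HarnessLib

/-!
# Every `E ∈ D⁺_qc(Mod 𝒪_X)` on a separated quasi-compact scheme is the class of a bounded-below complex of
# quasi-coherent modules (Görtz–Wedhorn II Lemma 22.36 ∕ Thm. 22.35; Hartshorne, *Residues and Duality*, II Cor. 7.19;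
# Thomason–Trobaugh B.16) — Stage I of the `D⁺_qc` comparison

For a SEPARATED scheme `X` with a FINITE AFFINE open cover `𝓤 = (U_i)` (e.g. quasi-compact separated; an abelian
variety) and `E : DerivedCategory.Plus X.Modules` with `E.IsGE a` whose cohomology sheaves are affine-localizing
(quasi-coherent, EGA I 1.4.1 ∕ Hartshorne II Lemma 5.3), there is a complex `M` of QUASI-COHERENT modules, strictly in
degrees `≥ a`, with `Q⁺⟨M, a⟩ ≅ E` (**`exists_qcRepresentative`**). Proof = the Čech zig-zag of the tree:
a bounded-below injective model `I•` of `E` (Mathlib CM5a), the quasi-isomorphism `I• ⥲ Tot Č•_ord(𝓤, I•)`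
(`Modules/CechOrderedBicomplex.quasiIso_toTotal`) and the quasi-isomorphism `Tot P̌•_ord(𝓤, I•) ⥲ Tot Č•_ord(𝓤, I•)`
(`Modules/CechLocalizedBicomplex.quasiIso_total_map_bicomplexCounit`: quasi-coherent base change along the affine
faces, Görtz–Wedhorn II Lemma 22.36), with `M := Tot P̌•_ord(𝓤, I•)`, whose terms are finite direct sums of the
localized-sections sheaves `P̌ᵖ(𝓤_p, Iᵠ)` — affine-localizing by `Modules/CechLocalizedSectionsAffineLocalizing` and
`Modules/AffineLocalizingBiproduct`:

* §1 total complexes of first-quadrant bicomplexes: `isStrictlyGE_total` (degrees), `isAffineLocalizing_total_X`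
  (terms: a coproduct with finite support);
* §2 **`exists_qcRepresentative`** (finite affine cover of a separated scheme), **`exists_qcRepresentative_of_compactSpace`**
  (quasi-compact separated scheme);
* §3 **`AbelianVariety.exists_qcRepresentative`** — the same on (the underlying scheme of) an abelian variety over a
  field, in the shape consumed by `Modules/BoundedCoherentVBModelsOfRepresentative.AbelianVariety.exists_vbModel_of_qcRepresentative_of_isLE`.

This file states and proves the STAGE-I theorem only. Its composition with
`AbelianVariety.exists_vbModel_of_qcRepresentative_of_isLE` (which would yield the tree's named fact
`ThomasonTrobaugh_vbModel_of_boundedCoh` on abelian varieties) is NOT performed here and nothing here claims it.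
Everything is PROVED; 0 named facts, no definitions, no instances (separatedness and quasi-compactness of an abelian
variety are derived inside the proof from `IsProper`). Typed for the cell `pub-hodge-ring2` — a research route
conditional on HC_CM, not a corollary; nothing in this file refers to it.

## References

* U. Görtz, T. Wedhorn, *Algebraic Geometry II: Cohomology of Schemes*, Springer Spektrum (2023): Lemma 22.36 and
  Thm. 22.35 (pp. 349–350), Lemma 21.75 (p. 264). [GortzWedhorn2023]
* R. Hartshorne, *Residues and Duality*, LNM 20 (1966), II Cor. 7.19 (p. 133). [HartshorneRD1966]
* R. W. Thomason, T. Trobaugh, *Higher algebraic K-theory of schemes and of derived categories*, The Grothendieck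
  Festschrift III (1990), Appendix B, B.16. [ThomasonTrobaugh1990]
* The Stacks Project, Tags 09T4 (`D(QCoh) → D_QCoh` for quasi-compact schemes with affine diagonal), 01LA. [StacksProject]
* D. Mumford, *Abelian Varieties* (1970), §4 (abelian varieties are complete, hence separated). [MumfordAV1970]
-/

noncomputable section

-- `TopCat.Presheaf`/`Scheme.Modules` and `HomologicalComplex₂.toGradedObject` are not reducible (as in Mathlib's
-- `AlgebraicGeometry/Modules/Sheaf.lean` and `Algebra/Homology/TotalComplex.lean`).
set_option backward.isDefEq.respectTransparency false

open CategoryTheory CategoryTheory.Limits AlgebraicGeometry TopologicalSpace Opposite HomologicalComplex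

universe w u

namespace Literature.AlgebraicGeometry.Modules

open Literature.AlgebraicGeometry.Motives Literature.Algebra.Homology

/-! ## §1 Total complexes of first-quadrant bicomplexes: degrees and terms -/

section Total

variable {C : Type*} [Category C] [Abelian C]
  [∀ K : HomologicalComplex₂ C (ComplexShape.up ℤ) (ComplexShape.up ℤ), K.HasTotal (ComplexShape.up ℤ)]

/-- **`Tot(K)` is concentrated in degrees `≥ n₀`** when the bicomplex `K` has no columns below `a`, every column is
concentrated in degrees `≥ p₀`, and `n₀ ≤ a + p₀`. [cite: Weibel1994, 1.2.6 (total complex)] [cite: GortzWedhorn2023, Lemma 21.75 (p. 264)] -/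
theorem isStrictlyGE_total (K : HomologicalComplex₂ C (ComplexShape.up ℤ) (ComplexShape.up ℤ)) (a p₀ n₀ : ℤ)
    (h : n₀ ≤ a + p₀) [CochainComplex.IsStrictlyGE K a] (hK : ∀ q : ℤ, CochainComplex.IsStrictlyGE (K.X q) p₀) :
    CochainComplex.IsStrictlyGE (K.total (ComplexShape.up ℤ)) n₀ := by
  rw [CochainComplex.isStrictlyGE_iff]
  intro n hn
  rw [IsZero.iff_id_eq_zero]
  refine HomologicalComplex₂.total.hom_ext _ fun q p (hqp : q + p = n) => ?_
  by_cases hq : q < a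
  · exact (isZero_X_X_of_isZero_X K (CochainComplex.isZero_of_isStrictlyGE K a q hq) p).eq_of_src _ _
  · haveI := hK q
    exact (CochainComplex.isZero_of_isStrictlyGE (K.X q) p₀ p (by omega)).eq_of_src _ _

end Total

section TotalTerms

variable {X : Scheme.{u}}

/-- **The terms of `Tot(K)` are affine-localizing** for a bicomplex `K` of `𝒪_X`-modules with no columns below `a`,
every column concentrated in degrees `≥ 0`, and affine-localizing entries: `Tot(K)ⁿ = ∐_{q + p = n} K^{q,p}` is a
coproduct whose summands off the finite set `a ≤ q ≤ n` are zero objects (`Modules/AffineLocalizingBiproduct`).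
[cite: StacksProject, Tag 01LA] [cite: GortzWedhorn2023, Lemma 22.36 (p. 349)] -/
theorem isAffineLocalizing_total_X (K : HomologicalComplex₂ X.Modules (ComplexShape.up ℤ) (ComplexShape.up ℤ))
    (a : ℤ) [CochainComplex.IsStrictlyGE K a] (hK0 : ∀ q : ℤ, CochainComplex.IsStrictlyGE (K.X q) 0)
    (hK : ∀ q p : ℤ, 0 ≤ p → IsAffineLocalizing ((K.X q).X p)) (n : ℤ) :
    IsAffineLocalizing ((K.total (ComplexShape.up ℤ)).X n) := by
  classical
  haveI : HasFiniteBiproducts X.Modules := HasFiniteBiproducts.of_hasFiniteProducts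
  -- the index set of the coproduct `Tot(K)ⁿ` and its finite support
  let J : Type := ↥(ComplexShape.π (ComplexShape.up ℤ) (ComplexShape.up ℤ) (ComplexShape.up ℤ) ⁻¹' {n})
  let f : J → X.Modules := K.toGradedObject.mapObjFun
    (ComplexShape.π (ComplexShape.up ℤ) (ComplexShape.up ℤ) (ComplexShape.up ℤ)) n
  have hf : ∀ j : J, f j = (K.X j.1.1).X j.1.2 := fun j => rfl
  have hj : ∀ j : J, j.1.1 + j.1.2 = n := fun j => j.2
  let emb : ℤ → J := fun q => ⟨(q, n - q), show q + (n - q) = n by omega⟩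
  let T : Finset J := (Finset.Icc a n).image emb
  have h0 : ∀ j : J, j ∉ T → IsZero (f j) := by
    intro j hjT
    rw [hf]
    by_cases hq : j.1.1 < a
    · exact isZero_X_X_of_isZero_X K (CochainComplex.isZero_of_isStrictlyGE K a _ hq) _
    · by_cases hp : j.1.2 < 0
      · haveI := hK0 j.1.1
        exact CochainComplex.isZero_of_isStrictlyGE (K.X j.1.1) 0 _ hp
      · exfalso
        refine hjT (Finset.mem_image.mpr ⟨j.1.1, Finset.mem_Icc.mpr ⟨by omega, by have := hj j; omega⟩, ?_⟩)
        apply Subtype.ext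
        refine Prod.ext rfl ?_
        change n - j.1.1 = j.1.2
        have := hj j
        omega
  have hfT : ∀ j ∈ T, IsAffineLocalizing (f j) := by
    intro j hjT
    obtain ⟨q, hq, rfl⟩ := Finset.mem_image.mp hjT
    rw [hf]
    exact hK q (n - q) (by have := Finset.mem_Icc.mp hq; omega)
  exact IsAffineLocalizing.sigmaObj_of_finite_support f T h0 hfT

end TotalTerms

/-! ## §2 The quasi-coherent representative on a separated scheme with a finite affine cover -/

section Representative

variable {X : Scheme.{u}} [X.IsSeparated]

/-- The terms of `Tot P̌•_ord(𝓤, I•)` are affine-localizing (separated `X`, finite affine family `𝓤`, any `I•` bounded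
below): entries `P̌ᵖ(𝓤_p, Iᵠ)` by `PCech.isAffineLocalizing_obj`. [cite: GortzWedhorn2023, Lemma 22.36 (p. 349)] -/
theorem PCechOrd.isAffineLocalizing_total_bicomplex_X {ι : Type u} [LinearOrder ι] [Fintype ι] (U : ι → X.Opens)
    (hU : ∀ i, IsAffineOpen (U i)) (I : CochainComplex X.Modules ℤ) (a : ℤ) [I.IsStrictlyGE a] (n : ℤ) :
    IsAffineLocalizing (((PCechOrd.bicomplex U I).total (ComplexShape.up ℤ)).X n) := by
  haveI := PCechOrd.isStrictlyGE_bicomplex U I a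
  refine isAffineLocalizing_total_X (PCechOrd.bicomplex U I) a
    (fun q => PCechOrd.isStrictlyGE_columnFunctor_obj U (I.X q)) (fun q p hp => ?_) n
  obtain ⟨p, rfl⟩ := Int.eq_ofNat_of_zero_le hp
  exact IsAffineLocalizing.of_iso (PCechOrd.bicomplexXXIso U I q p).symm
    (PCech.isAffineLocalizing_obj (CechOrd.faces U p) 0 (I.X q) fun V hV β =>
      hV.inf (PCechOrd.isAffineOpen_face_faces U hU β))

/-- **Stage I of the `D⁺_qc` comparison (Görtz–Wedhorn II Lemma 22.36 ∕ Thm. 22.35, Hartshorne RD II 7.19,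
Thomason–Trobaugh B.16; bounded below): on a SEPARATED scheme `X` with a FINITE AFFINE open cover `𝓤`, every object
`E` of `D⁺(Mod 𝒪_X)` with `E.IsGE a` whose cohomology sheaves are affine-localizing (quasi-coherent) is the class
`Q⁺⟨M, a, _⟩` of a complex `M` of QUASI-COHERENT modules strictly in degrees `≥ a`.** Proof: an injective model
`I•` of `E`; the zig-zag of quasi-isomorphisms `I• ⥲ Tot Č•_ord(𝓤, I•) ⭀ Tot P̌•_ord(𝓤, I•) =: M`, inverted by `Q⁺`;
the terms of `M` are finite direct sums of the quasi-coherent sheaves `P̌ᵖ(𝓤_p, Iᵠ)`.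
[cite: GortzWedhorn2023, Lemma 22.36 and Thm. 22.35 (pp. 349–350)] [cite: HartshorneRD1966, II Cor. 7.19 (p. 133)]
[cite: ThomasonTrobaugh1990, Appendix B, B.16] -/
theorem exists_qcRepresentative [HasDerivedCategory.{w} X.Modules] {ι : Type u} [LinearOrder ι] [Fintype ι]
    (U : ι → X.Opens) (hU : ∀ i, IsAffineOpen (U i)) (hcov : ⨆ i, U i = ⊤)
    (E : DerivedCategory.Plus X.Modules) (a : ℤ) [E.IsGE a]
    (hqc : ∀ k : ℤ, IsAffineLocalizing ((DerivedCategory.Plus.homologyFunctor _ k).obj E)) :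
    ∃ (M : CochainComplex X.Modules ℤ) (hn : M.IsStrictlyGE a),
      (∀ i, (M.X i).IsQuasicoherent) ∧ (∀ i, IsAffineLocalizing (M.X i)) ∧
      Nonempty (DerivedCategory.Plus.Q.obj ⟨M, a, hn⟩ ≅ E) := by
  -- a bounded-below representative of `E`, then an injective model
  obtain ⟨K₀, hK₀, ⟨e₀⟩⟩ := (DerivedCategory.Plus.ι.obj E).exists_iso_Q_obj_of_isGE a
  obtain ⟨I, ι', hι, hIinj, hIa⟩ := CochainComplex.Plus.modelCategoryQuillen.exists_quasiIso_injective K₀ a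
  haveI := hι
  haveI := hIinj
  haveI := hIa
  -- `E ≅ Q⁺ K₀ ≅ Q⁺ I`
  let eK₀ : DerivedCategory.Plus.Q.obj ⟨K₀, a, hK₀⟩ ≅ E :=
    (DerivedCategory.TStructure.t (C := X.Modules)).plus.fullyFaithfulι.preimageIso
      (ιQObjIso (⟨K₀, a, hK₀⟩ : CochainComplex.Plus _) ≪≫ e₀.symm)
  let ι'' : (⟨K₀, a, hK₀⟩ : CochainComplex.Plus X.Modules) ⟶ ⟨I, a, hIa⟩ := ObjectProperty.homMk ι'
  haveI : QuasiIso ι''.hom := hι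
  haveI := Functor.isIso_Q_map_of_quasiIso (C := X.Modules) ι''
  let eI : DerivedCategory.Plus.Q.obj ⟨I, a, hIa⟩ ≅ E := (asIso (DerivedCategory.Plus.Q.map ι'')).symm ≪≫ eK₀
  -- the cohomology sheaves of `I` are those of `E`: affine-localizing; the terms are acyclic on affine opens
  have hH : ∀ i, IsAffineLocalizing (I.homology i) := fun i =>
    IsAffineLocalizing.of_iso ((DerivedCategory.Plus.homologyFunctor _ i).mapIso eI.symm ≪≫
      plusHomologyFunctorQObjIso ⟨I, a, hIa⟩ i) (hqc i)
  have hI : ∀ (q : ℤ) ⦃O : X.Opens⦄, IsAffineOpen O → IsAcyclicOn (I.X q) O :=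
    fun q O _ => IsAcyclicOn.of_injective (I.X q) O
  -- the zig-zag `I ⥲ Tot Č ⭀ Tot P̌`
  haveI hTC : CochainComplex.IsStrictlyGE ((CechOrd.bicomplex U I).total (ComplexShape.up ℤ)) a := by
    haveI := CechOrd.isStrictlyGE_bicomplex U I a
    exact isStrictlyGE_total _ a 0 a (by omega) fun q => CechOrd.isStrictlyGE_columnFunctor_obj U (I.X q)
  haveI hTP : CochainComplex.IsStrictlyGE ((PCechOrd.bicomplex U I).total (ComplexShape.up ℤ)) a := by
    haveI := PCechOrd.isStrictlyGE_bicomplex U I a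
    exact isStrictlyGE_total _ a 0 a (by omega) fun q => PCechOrd.isStrictlyGE_columnFunctor_obj U (I.X q)
  let t' : (⟨I, a, hIa⟩ : CochainComplex.Plus X.Modules) ⟶
      ⟨(CechOrd.bicomplex U I).total (ComplexShape.up ℤ), a, hTC⟩ :=
    ObjectProperty.homMk (CechOrd.toTotal U I hcov)
  haveI : QuasiIso t'.hom := CechOrd.quasiIso_toTotal U I hcov a
  haveI := Functor.isIso_Q_map_of_quasiIso (C := X.Modules) t'
  let c' : (⟨(PCechOrd.bicomplex U I).total (ComplexShape.up ℤ), a, hTP⟩ : CochainComplex.Plus X.Modules) ⟶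
      ⟨(CechOrd.bicomplex U I).total (ComplexShape.up ℤ), a, hTC⟩ :=
    ObjectProperty.homMk (HomologicalComplex₂.total.map (PCechOrd.bicomplexCounit U I) (ComplexShape.up ℤ))
  haveI : QuasiIso c'.hom := PCechOrd.quasiIso_total_map_bicomplexCounit U I hU hI hH a
  haveI := Functor.isIso_Q_map_of_quasiIso (C := X.Modules) c'
  have hM : ∀ i, IsAffineLocalizing (((PCechOrd.bicomplex U I).total (ComplexShape.up ℤ)).X i) :=
    PCechOrd.isAffineLocalizing_total_bicomplex_X U hU I a
  exact ⟨(PCechOrd.bicomplex U I).total (ComplexShape.up ℤ), hTP,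
    fun i => isQuasicoherent_of_isAffineLocalizing (hM i), hM,
    ⟨asIso (DerivedCategory.Plus.Q.map c') ≪≫ (asIso (DerivedCategory.Plus.Q.map t')).symm ≪≫ eI⟩⟩

omit [X.IsSeparated] in
/-- A quasi-compact scheme has a finite affine open cover indexed by `Fin m` (reindexing
`Modules/IdealSheafNoetherian.exists_finite_affineOpens_iSup_eq_top`). [cite: GortzWedhorn2023, Thm. 22.9 (p. 332)]
[cite: StacksProject, Tag 09T4] -/
theorem exists_fin_affine_cover [CompactSpace X] :
    ∃ (m : ℕ) (U : Fin m → X.Opens), (∀ i, IsAffineOpen (U i)) ∧ ⨆ i, U i = ⊤ := by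
  obtain ⟨t, ht⟩ := exists_finite_affineOpens_iSup_eq_top (X := X)
  classical
  let e := Fintype.equivFin (↥t)
  refine ⟨Fintype.card ↥t, fun i => ((e.symm i : ↥t) : X.affineOpens), fun i => ((e.symm i : ↥t) : X.affineOpens).2, ?_⟩
  rw [← ht]
  exact e.symm.iSup_comp (g := fun V : ↥t => ((V : X.affineOpens) : X.Opens))

/-- **Stage I on a quasi-compact separated scheme**: every `E ∈ D⁺(Mod 𝒪_X)` with `E.IsGE a` and affine-localizing
(quasi-coherent) cohomology sheaves is `Q⁺⟨M, a, _⟩` for a complex `M` of quasi-coherent modules (finite affine cover by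
quasi-compactness, then `exists_qcRepresentative`). [cite: GortzWedhorn2023, Lemma 22.36 and Thm. 22.35 (pp. 349–350)]
[cite: HartshorneRD1966, II Cor. 7.19 (p. 133)] [cite: StacksProject, Tag 09T4] -/
theorem exists_qcRepresentative_of_compactSpace [CompactSpace X] [HasDerivedCategory.{w} X.Modules]
    (E : DerivedCategory.Plus X.Modules) (a : ℤ) [E.IsGE a]
    (hqc : ∀ k : ℤ, IsAffineLocalizing ((DerivedCategory.Plus.homologyFunctor _ k).obj E)) :
    ∃ (M : CochainComplex X.Modules ℤ) (hn : M.IsStrictlyGE a),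
      (∀ i, (M.X i).IsQuasicoherent) ∧ (∀ i, IsAffineLocalizing (M.X i)) ∧
      Nonempty (DerivedCategory.Plus.Q.obj ⟨M, a, hn⟩ ≅ E) := by
  obtain ⟨m, U, hU, hcov⟩ := exists_fin_affine_cover (X := X)
  -- lift the index type to universe `u`
  let U' : ULift.{u} (Fin m) → X.Opens := fun i => U i.down
  have hcov' : ⨆ i, U' i = ⊤ := by
    rw [← hcov]
    exact Equiv.ulift.iSup_comp (g := U)
  exact exists_qcRepresentative U' (fun i => hU i.down) hcov' E a hqc

end Representative

/-! ## §3 Abelian varieties -/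

section AbelianVariety

/-- **Stage I of the `D⁺_qc` comparison on an abelian variety**: for an abelian variety `B` over a field `k` (proper,
hence separated and quasi-compact over `Spec k`), every `E ∈ D⁺(Mod 𝒪_B)` with `E.IsGE a` whose cohomology sheaves are
affine-localizing (quasi-coherent) is the class `Q⁺⟨M, a, _⟩` of a bounded-below complex `M` of QUASI-COHERENT modules
(Görtz–Wedhorn II Lemma 22.36 ∕ Hartshorne RD II Cor. 7.19 ∕ Thomason–Trobaugh B.16, via `exists_qcRepresentative_of_compactSpace`).
This is the Stage-I theorem only; its composition with
`AbelianVariety.exists_vbModel_of_qcRepresentative_of_isLE` is not performed here.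
[cite: GortzWedhorn2023, Lemma 22.36 and Thm. 22.35 (pp. 349–350)] [cite: HartshorneRD1966, II Cor. 7.19 (p. 133)]
[cite: MumfordAV1970, §4 (definition: complete, hence separated)] -/
theorem AbelianVariety.exists_qcRepresentative {k : Type u} [Field k] (B : AbelianVariety k)
    [HasDerivedCategory.{w} B.X.left.Modules] (E : DerivedCategory.Plus B.X.left.Modules) (a : ℤ) [E.IsGE a]
    (hqc : ∀ i : ℤ, IsAffineLocalizing ((DerivedCategory.Plus.homologyFunctor _ i).obj E)) :
    ∃ (M : CochainComplex B.X.left.Modules ℤ) (hn : M.IsStrictlyGE a),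
      (∀ i, (M.X i).IsQuasicoherent) ∧ (∀ i, IsAffineLocalizing (M.X i)) ∧
      Nonempty (DerivedCategory.Plus.Q.obj ⟨M, a, hn⟩ ≅ E) := by
  haveI : B.X.left.IsSeparated := by
    constructor
    rw [← terminal.comp_from B.X.hom]
    infer_instance
  haveI : CompactSpace B.X.left := QuasiCompact.compactSpace_of_compactSpace B.X.hom
  exact exists_qcRepresentative_of_compactSpace E a hqc

end AbelianVariety

end Literature.AlgebraicGeometry.Modules

end
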